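import Mathlib.RingTheory.Henselian
import Mathlib.RingTheory.AdicCompletion.Basic
import Mathlib.RingTheory.DiscreteValuationRing.Basic
import Mathlib.Analysis.SpecificLimits.Normed
import Literature.NumberTheory.EllipticCurves.TateCurve.ValuationRing
import HarnessLib

/-!
# The ring of integers of a complete non-archimedean field is Henselian (Hensel's lemma)

Topic `Literature/NumberTheory/EllipticCurves/TateCurve`, namespace
`Literature.NumberTheory.EllipticCurves.TateCurve` (abc-iut cell, TRANCHE-T1 P21; the input of
(iii) ⇒ (ii) in Silverman ATAEC Thm. V.5.3 (b): "It follows from Hensel's lemma applied to the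
polynomial `T² + a₁T - a₂` …", PDF p. 409). Setting of `TateCurve/ValuationRing.lean`: `K` a
complete ultrametric normed field, `R` a discrete valuation ring with fraction field `K` and
`‖x‖ ≤ 1 ↔ x ∈ R`. PROVED here:

* `pow_dvd_iff_norm_le`: `ϖⁿ ∣ x ↔ ‖x‖ ≤ ‖ϖ‖ⁿ` for a uniformiser `ϖ`;
* `isAdicComplete`: `R` is `𝔐`-adically complete — Hausdorff by Krull's intersection theorem,
  precomplete because an `𝔐`-adic Cauchy sequence is `‖·‖`-Cauchy in the complete field `K`, its
  limit has norm `≤ 1`, hence lies in `R`, and is an `𝔐`-adic limit (closed balls);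
* `henselianLocalRing`: **`R` is Henselian** (Mathlib's `IsAdicComplete.henselianRing`), i.e.
  HENSEL'S LEMMA: a simple root modulo `𝔐` of a monic polynomial over `R` lifts to a root in `R`
  (`exists_isRoot_of_isUnit_derivative`).

(Neukirch, *Algebraic Number Theory*, II (4.6) Hensel's Lemma; the tree has the analogous facts
for the completion of a number field at a finite place in `Summits/Ventures/HodgeRepro2/
T5AdicCompletionHenselian.lean`, via compactness; here completeness of `K` is used instead.)

## References
* [NeukirchANT1999] J. Neukirch, *Algebraic Number Theory*, Springer 1999, Ch. II (4.6)
  (Hensel's Lemma for complete valued fields) and (3.8).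
* [SilvermanATAEC1994] J. H. Silverman, *Advanced Topics in the Arithmetic of Elliptic Curves*,
  GTM 151, proof of Thm. V.5.3 (b) (PDF p. 409, the appeal to Hensel's lemma).
-/

noncomputable section

open IsDedekindDomain IsLocalRing Filter Topology

namespace Literature.NumberTheory.EllipticCurves.TateCurve

universe u

variable {K : Type u} [NontriviallyNormedField K]
  {R : Type u} [CommRing R] [IsDomain R] [IsDiscreteValuationRing R] [Algebra R K]
  [IsFractionRing R K]

/-- A uniformiser has norm `< 1` (it lies in `𝔐 = {‖·‖ < 1}`). [cite: NeukirchANT1999, Ch. II Prop. 3.8] -/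
theorem norm_lt_one_of_irreducible (hR : ∀ x : K, ‖x‖ ≤ 1 ↔ x ∈ Set.range (algebraMap R K))
    {ϖ : R} (hϖ : Irreducible ϖ) : ‖algebraMap R K ϖ‖ < 1 :=
  (mem_maximalIdeal_iff_norm_lt_one hR ϖ).mp
    (hϖ.maximalIdeal_eq ▸ Ideal.mem_span_singleton_self ϖ)

omit [IsDomain R] [IsDiscreteValuationRing R] in
/-- A uniformiser is nonzero in `K`. [cite: NeukirchANT1999, Ch. II Prop. 3.8] -/
theorem norm_pos_of_irreducible {ϖ : R} (hϖ : Irreducible ϖ) : 0 < ‖algebraMap R K ϖ‖ :=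
  norm_pos_iff.mpr ((map_ne_zero_iff _ (IsFractionRing.injective R K)).mpr hϖ.ne_zero)

/-- **`ϖⁿ ∣ x ↔ ‖x‖ ≤ ‖ϖ‖ⁿ`** for a uniformiser `ϖ` of `R` and `x ∈ R` (write `x = u ϖᵏ`,
`‖x‖ = ‖ϖ‖ᵏ`). [cite: NeukirchANT1999, Ch. II Prop. 3.8] -/
theorem pow_dvd_iff_norm_le (hR : ∀ x : K, ‖x‖ ≤ 1 ↔ x ∈ Set.range (algebraMap R K))
    {ϖ : R} (hϖ : Irreducible ϖ) (x : R) (n : ℕ) :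
    ϖ ^ n ∣ x ↔ ‖algebraMap R K x‖ ≤ ‖algebraMap R K ϖ‖ ^ n := by
  constructor
  · rintro ⟨t, rfl⟩
    rw [map_mul, map_pow, norm_mul, norm_pow]
    exact mul_le_of_le_one_right (pow_nonneg (norm_nonneg _) _) (norm_algebraMap_le_one hR t)
  · intro h
    rcases eq_or_ne x 0 with rfl | hx
    · exact dvd_zero _
    obtain ⟨k, u, rfl⟩ := IsDiscreteValuationRing.eq_unit_mul_pow_irreducible hx hϖ
    have hu : ‖algebraMap R K (u : R)‖ = 1 := (isUnit_iff_norm_eq_one hR _).mp u.isUnit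
    rw [map_mul, map_pow, norm_mul, hu, one_mul, norm_pow] at h
    have hnk : n ≤ k :=
      (pow_le_pow_iff_right_of_lt_one₀ (norm_pos_of_irreducible hϖ)
        (norm_lt_one_of_irreducible hR hϖ)).mp h
    exact Dvd.dvd.mul_left (pow_dvd_pow ϖ hnk) _

omit [IsDomain R] [IsDiscreteValuationRing R] [Algebra R K] [IsFractionRing R K] in
/-- Membership in `I • ⊤` is membership in `I`. [folklore] -/
private theorem mem_smul_top_iff (I : Ideal R) (x : R) :
    x ∈ I • (⊤ : Submodule R R) ↔ x ∈ I := by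
  rw [Ideal.smul_top_eq_map]
  simp

omit [Algebra R K] [IsFractionRing R K] in
/-- `x ∈ 𝔐ⁿ ↔ ϖⁿ ∣ x`. [folklore] -/
private theorem mem_maximalIdeal_pow_iff {ϖ : R} (hϖ : Irreducible ϖ) (n : ℕ) (x : R) :
    x ∈ (maximalIdeal R) ^ n ↔ ϖ ^ n ∣ x := by
  rw [hϖ.maximalIdeal_eq, Ideal.span_singleton_pow, Ideal.mem_span_singleton]

omit [Algebra R K] [IsFractionRing R K] in
/-- `R` is `𝔐`-adically Hausdorff: `⋂ 𝔐ⁿ = 0` (Krull's intersection theorem for the Noetherian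
local ring `R`). [cite: NeukirchANT1999, Ch. II (4.6)] -/
theorem isHausdorff_maximalIdeal : IsHausdorff (maximalIdeal R) R :=
  ⟨fun x hx ↦ by
    have h : x ∈ ⨅ n : ℕ, (maximalIdeal R) ^ n :=
      Ideal.mem_iInf.mpr fun n ↦ (mem_smul_top_iff _ _).mp (SModEq.zero.mp (hx n))
    rwa [Ideal.iInf_pow_eq_bot_of_isLocalRing _ (maximalIdeal.isMaximal R).ne_top,
      Ideal.mem_bot] at h⟩

variable [CompleteSpace K]

/-- `R` is `𝔐`-adically precomplete when `K` is complete: an `𝔐`-adic Cauchy sequence `f` in `R`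
satisfies `‖f m - f n‖ ≤ ‖ϖ‖ᵐ` (`m ≤ n`), so converges in `K`; the limit has norm `≤ 1`, i.e.
lies in `R`, and `‖f n - L‖ ≤ ‖ϖ‖ⁿ`, i.e. `f n ≡ L (mod 𝔐ⁿ)`. [cite: NeukirchANT1999, Ch. II (4.6)] -/
theorem isPrecomplete_maximalIdeal
    (hR : ∀ x : K, ‖x‖ ≤ 1 ↔ x ∈ Set.range (algebraMap R K)) :
    IsPrecomplete (maximalIdeal R) R := by
  refine ⟨fun f hf ↦ ?_⟩
  obtain ⟨ϖ, hϖ⟩ := IsDiscreteValuationRing.exists_irreducible R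
  set r : ℝ := ‖algebraMap R K ϖ‖ with hr
  have hr1 : r < 1 := norm_lt_one_of_irreducible hR hϖ
  have hr0 : 0 ≤ r := norm_nonneg _
  -- `‖f m - f n‖ ≤ r ^ m` for `m ≤ n`
  have hdist : ∀ {m n : ℕ}, m ≤ n →
      ‖algebraMap R K (f m) - algebraMap R K (f n)‖ ≤ r ^ m := by
    intro m n hmn
    have h := (mem_maximalIdeal_pow_iff hϖ m _).mp
      ((mem_smul_top_iff _ _).mp (SModEq.sub_mem.mp (hf hmn)))
    rw [← map_sub]
    exact (pow_dvd_iff_norm_le hR hϖ _ m).mp h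
  set g : ℕ → K := fun n ↦ algebraMap R K (f n) with hg
  have hcauchy : CauchySeq g := by
    refine cauchySeq_of_le_geometric r 1 hr1 fun n ↦ ?_
    rw [dist_eq_norm, one_mul]
    exact hdist (Nat.le_succ n)
  obtain ⟨L', hL'⟩ := cauchySeq_tendsto_of_complete hcauchy
  -- the limit lies in `R`
  have hL'1 : ‖L'‖ ≤ 1 :=
    le_of_tendsto' hL'.norm fun n ↦ norm_algebraMap_le_one hR (f n)
  obtain ⟨L, hL⟩ := (hR L').mp hL'1
  refine ⟨L, fun n ↦ ?_⟩
  -- `‖f n - L‖ ≤ r ^ n`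
  have hle : ‖algebraMap R K (f n) - L'‖ ≤ r ^ n := by
    have ht : Tendsto (fun k ↦ ‖g n - g k‖) atTop (𝓝 ‖algebraMap R K (f n) - L'‖) :=
      (tendsto_const_nhds.sub hL').norm
    exact le_of_tendsto ht (eventually_atTop.mpr ⟨n, fun k hk ↦ hdist hk⟩)
  rw [SModEq.sub_mem, mem_smul_top_iff, mem_maximalIdeal_pow_iff hϖ, pow_dvd_iff_norm_le hR hϖ,
    map_sub, hL]
  exact hle

/-- **The ring of integers of a complete non-archimedean field is `𝔐`-adically complete.**
[cite: NeukirchANT1999, Ch. II (4.6)] -/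
theorem isAdicComplete (hR : ∀ x : K, ‖x‖ ≤ 1 ↔ x ∈ Set.range (algebraMap R K)) :
    IsAdicComplete (maximalIdeal R) R :=
  { toIsHausdorff := isHausdorff_maximalIdeal
    toIsPrecomplete := isPrecomplete_maximalIdeal hR }

/-- **Hensel's lemma: the ring of integers `R` of a complete non-archimedean field `K` is a
Henselian local ring** (Mathlib's `IsAdicComplete.henselianRing` at the maximal ideal; Neukirch,
*Algebraic Number Theory* II (4.6)). [cite: NeukirchANT1999, Ch. II (4.6)] -/
theorem henselianLocalRing (hR : ∀ x : K, ‖x‖ ≤ 1 ↔ x ∈ Set.range (algebraMap R K)) :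
    HenselianLocalRing R :=
  haveI := isAdicComplete hR
  { is_henselian := fun f hf a₀ h₁ h₂ ↦
      HenselianRing.is_henselian (I := maximalIdeal R) f hf a₀ h₁ (h₂.map (Ideal.Quotient.mk _)) }

/-- **Hensel's lemma** in the form used by Silverman (proof of ATAEC V.5.3 (b), PDF p. 409): a
simple root modulo `𝔐` of a monic polynomial over the ring of integers of a complete
non-archimedean field lifts to a root. [cite: NeukirchANT1999, Ch. II (4.6)] -/
theorem exists_isRoot_of_isUnit_derivative
    (hR : ∀ x : K, ‖x‖ ≤ 1 ↔ x ∈ Set.range (algebraMap R K)) (f : Polynomial R) (hf : f.Monic)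
    (a₀ : R) (h₁ : f.eval a₀ ∈ maximalIdeal R) (h₂ : IsUnit (f.derivative.eval a₀)) :
    ∃ a : R, f.IsRoot a ∧ a - a₀ ∈ maximalIdeal R :=
  (henselianLocalRing hR).is_henselian f hf a₀ h₁ h₂

end Literature.NumberTheory.EllipticCurves.TateCurve

end
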